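import Mathlib
import HarnessLib
import Summits.ValiantsHypothesis.ValiantsHypothesis.Theses.MonotoneRestoration
import Literature.Computability.AlgebraicComplexity.ArithCircuit
import Literature.Computability.AlgebraicComplexity.ArithCircuitProofs
import Literature.Computability.AlgebraicComplexity.MonotoneStructure
import Literature.Computability.AlgebraicComplexity.PermanentIrreducible
import Literature.ModelTheory.FiniteModelTheory.CkEquiv
import Summits.ValiantsHypothesis.ValiantsHypothesis.Theorems.MonotoneRestorationMonotoneRestorationQPCosetCount
import Summits.ValiantsHypothesis.ValiantsHypothesis.Theorems.MonotoneRestorationMonotoneRestorationQPSymmetricLB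
import Summits.ValiantsHypothesis.ValiantsHypothesis.Theorems.MonotoneRestorationMonotoneRestorationQPSupportSymmetrisation
import Summits.ValiantsHypothesis.ValiantsHypothesis.Theorems.MonotoneRestorationMonotoneRestorationQPSparseRegime
import Summits.ValiantsHypothesis.ValiantsHypothesis.Theorems.MonotoneRestorationMonotoneRestorationQPBeta
import Literature.Computability.AlgebraicComplexity.SymmetricArithCircuit
import Literature.Computability.AlgebraicComplexity.DawarWilsenach2025Proofs
import Literature.GroupTheory.PermutationGroups.SmallIndexSubgroups
import Summits.ValiantsHypothesis.ValiantsHypothesis.Theorems.MonotoneRestorationQP.Negative.LoadBearing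
import Summits.ValiantsHypothesis.ValiantsHypothesis.Theorems.MonotoneRestorationMonotoneRestorationQPPermSupportCount

/-! TTRL-lite variant V20181 of stmt-ValiantsHypothesis-15886 -/

namespace Summit.ValiantsHypothesis.ValiantsHypothesis.Theorems

open Summit.ValiantsHypothesis.ValiantsHypothesis.Theses.MonotoneRestoration
open Literature.Computability.AlgebraicComplexity

/-- Full monomial expansion of a block of row sums: the product over `i ∈ t` of the
`i`-th row sum `∑ j, X (i, j)` equals the sum over all maps `φ : t → Fin n` of the
monomials `∏ i : t, X (i, φ i)` (TTRL-lite variant V20181 of `stub_esymmRowSums_structure`). -/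
theorem stub_esymmRowSums_structure_var20181 :
    ∀ (n : ℕ) (t : Finset (Fin n)), ∏ i ∈ t, ∑ j : Fin n,
      (MvPolynomial.X (i, j) : MvPolynomial (Fin n × Fin n) NNReal) =
      ∑ φ : t → Fin n, ∏ i : t,
        (MvPolynomial.X ((i : Fin n), φ i) : MvPolynomial (Fin n × Fin n) NNReal) := by
  intro n t
  rw [← Finset.prod_coe_sort t, Fintype.prod_sum]

end Summit.ValiantsHypothesis.ValiantsHypothesis.Theorems
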